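import Summits.QuantumFields.YangMills.Theorems.GronwallGapAnalyticDetourStrongCouplingWindow

/-!
# Crux `AnalyticDetour` (stmt-QuantumFields-8801), line `registered`:
# reduction of the crux to its open core (the anchored detour)

Route `GronwallGap`, sub-problem `YangMills`.  With the strong-coupling window now a theorem
(`stub_strongCouplingWindow`), the crux
`Summit.QuantumFields.YangMills.Theses.GronwallGap.AnalyticDetour` follows from the single open
statement `stub_anchoredDetour` of the skeleton (off a locally finite `E`, every Wilson point
`β > 0`, `β ∉ E`, is reached from anchors arbitrarily deep in strong coupling by an admissible
weight path with Gateaux-analytic torus pressure at every parameter) by CONCATENATION of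
admissible analytic paths — the birth skeleton's glue (planner `Lines/birth.lean`), made importable
here: `β₁` from the window; `E` and an anchor `βa ∈ (0, β₁)` from the detour; for `β ∉ E`,
`βs ∈ (0, β₁)` run the window path `βs ⇝ βa` at double speed on `[0, ½]` and the detour `βa ⇝ β`
on `[½, 1]` (pointwise clauses transfer branchwise; the log-Lipschitz constant becomes
`2(|Λ₁| + |Λ₂|)`, the junction being handled through the common Wilson point).

`stub_reductionToAnchoredDetour` is CONDITIONAL on its hypothesis (the open core, stated verbatim
as registered on the ledger); it closes nothing by itself.  No named facts; no definitions (the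
concatenated path is the explicit lambda `fun s => if s ≤ 1/2 then w₁ (2s) else w₂ (2s-1)`).
-/

noncomputable section

namespace Summit.QuantumFields.YangMills.Theorems

open scoped BigOperators

/-- Pointwise-in-`s` properties transfer to the concatenated path
`s ↦ if s ≤ 1/2 then w₁ (2s) else w₂ (2s-1)`. -/
private theorem concatPath_forall {G : Type} (Q : (G → ℝ) → Prop) {w₁ w₂ : ℝ → G → ℝ}
    (hQ₁ : ∀ s ∈ Set.Icc (0 : ℝ) 1, Q (w₁ s)) (hQ₂ : ∀ s ∈ Set.Icc (0 : ℝ) 1, Q (w₂ s)) :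
    ∀ s ∈ Set.Icc (0 : ℝ) 1, Q ((fun s : ℝ => if s ≤ 1 / 2 then w₁ (2 * s) else w₂ (2 * s - 1)) s) := by
  intro s hs
  obtain ⟨hs0, hs1⟩ := hs
  by_cases h : s ≤ 1 / 2
  · simp only [if_pos h]
    exact hQ₁ (2 * s) ⟨by linarith, by linarith⟩
  · simp only [if_neg h]
    rw [not_le] at h
    exact hQ₂ (2 * s - 1) ⟨by linarith, by linarith⟩

/-- Log-Lipschitz control of the concatenated path, ordered parameters (junction through
`w₁ 1 = w₂ 0`). -/
private theorem concatPath_log_lipschitz_of_le {G : Type} {w₁ w₂ : ℝ → G → ℝ} {Λ₁ Λ₂ : ℝ}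
    (hL₁ : ∀ s ∈ Set.Icc (0 : ℝ) 1, ∀ s' ∈ Set.Icc (0 : ℝ) 1, ∀ g : G,
      |Real.log (w₁ s g) - Real.log (w₁ s' g)| ≤ Λ₁ * |s - s'|)
    (hL₂ : ∀ s ∈ Set.Icc (0 : ℝ) 1, ∀ s' ∈ Set.Icc (0 : ℝ) 1, ∀ g : G,
      |Real.log (w₂ s g) - Real.log (w₂ s' g)| ≤ Λ₂ * |s - s'|)
    (hjoin : w₁ 1 = w₂ 0) {s s' : ℝ} (hss' : s ≤ s')
    (hs : s ∈ Set.Icc (0 : ℝ) 1) (hs' : s' ∈ Set.Icc (0 : ℝ) 1) (g : G) :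
    |Real.log ((fun s : ℝ => if s ≤ 1 / 2 then w₁ (2 * s) else w₂ (2 * s - 1)) s g) -
        Real.log ((fun s : ℝ => if s ≤ 1 / 2 then w₁ (2 * s) else w₂ (2 * s - 1)) s' g)| ≤
      2 * (|Λ₁| + |Λ₂|) * (s' - s) := by
  obtain ⟨hs0, hs1⟩ := hs
  obtain ⟨hs0', hs1'⟩ := hs'
  have hA₁ : 0 ≤ |Λ₁| := abs_nonneg _
  have hA₂ : 0 ≤ |Λ₂| := abs_nonneg _
  have hΛ₁ : Λ₁ ≤ |Λ₁| := le_abs_self _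
  have hΛ₂ : Λ₂ ≤ |Λ₂| := le_abs_self _
  by_cases h' : s' ≤ 1 / 2
  · have h : s ≤ 1 / 2 := le_trans hss' h'
    simp only [if_pos h, if_pos h']
    have key := hL₁ (2 * s) ⟨by linarith, by linarith⟩ (2 * s') ⟨by linarith, by linarith⟩ g
    have e : |2 * s - 2 * s'| = 2 * (s' - s) := by
      rw [abs_of_nonpos (by linarith)]; ring
    rw [e] at key
    have m : Λ₁ * (2 * (s' - s)) ≤ |Λ₁| * (2 * (s' - s)) :=
      mul_le_mul_of_nonneg_right hΛ₁ (by linarith)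
    have n : 0 ≤ |Λ₂| * (s' - s) := mul_nonneg hA₂ (by linarith)
    linarith
  · rw [not_le] at h'
    by_cases h : s ≤ 1 / 2
    · simp only [if_pos h, if_neg (not_le.mpr h')]
      have k1 := hL₁ (2 * s) ⟨by linarith, by linarith⟩ 1 ⟨by norm_num, by norm_num⟩ g
      have k2 := hL₂ 0 ⟨le_rfl, by norm_num⟩ (2 * s' - 1) ⟨by linarith, by linarith⟩ g
      have e1 : |2 * s - 1| = 1 - 2 * s := by
        rw [abs_of_nonpos (by linarith)]; ring
      have e2 : |(0 : ℝ) - (2 * s' - 1)| = 2 * s' - 1 := by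
        rw [abs_of_nonpos (by linarith)]; ring
      rw [e1] at k1
      rw [e2] at k2
      have hj : w₁ 1 g = w₂ 0 g := by rw [hjoin]
      rw [hj] at k1
      have tri := abs_sub_le (Real.log (w₁ (2 * s) g)) (Real.log (w₂ 0 g))
        (Real.log (w₂ (2 * s' - 1) g))
      have m1 : Λ₁ * (1 - 2 * s) ≤ |Λ₁| * (1 - 2 * s) :=
        mul_le_mul_of_nonneg_right hΛ₁ (by linarith)
      have m2 : Λ₂ * (2 * s' - 1) ≤ |Λ₂| * (2 * s' - 1) :=
        mul_le_mul_of_nonneg_right hΛ₂ (by linarith)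
      have n1 : 0 ≤ |Λ₁| * (2 * s' - 1) := mul_nonneg hA₁ (by linarith)
      have n2 : 0 ≤ |Λ₂| * (1 - 2 * s) := mul_nonneg hA₂ (by linarith)
      linarith
    · rw [not_le] at h
      simp only [if_neg (not_le.mpr h), if_neg (not_le.mpr h')]
      have key := hL₂ (2 * s - 1) ⟨by linarith, by linarith⟩ (2 * s' - 1)
        ⟨by linarith, by linarith⟩ g
      have e : |2 * s - 1 - (2 * s' - 1)| = 2 * (s' - s) := by
        rw [abs_of_nonpos (by linarith)]; ring
      rw [e] at key
      have m : Λ₂ * (2 * (s' - s)) ≤ |Λ₂| * (2 * (s' - s)) :=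
        mul_le_mul_of_nonneg_right hΛ₂ (by linarith)
      have n : 0 ≤ |Λ₁| * (s' - s) := mul_nonneg hA₁ (by linarith)
      linarith

/-- Log-Lipschitz control of the concatenated path. -/
private theorem concatPath_log_lipschitz {G : Type} {w₁ w₂ : ℝ → G → ℝ} {Λ₁ Λ₂ : ℝ}
    (hL₁ : ∀ s ∈ Set.Icc (0 : ℝ) 1, ∀ s' ∈ Set.Icc (0 : ℝ) 1, ∀ g : G,
      |Real.log (w₁ s g) - Real.log (w₁ s' g)| ≤ Λ₁ * |s - s'|)
    (hL₂ : ∀ s ∈ Set.Icc (0 : ℝ) 1, ∀ s' ∈ Set.Icc (0 : ℝ) 1, ∀ g : G,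
      |Real.log (w₂ s g) - Real.log (w₂ s' g)| ≤ Λ₂ * |s - s'|)
    (hjoin : w₁ 1 = w₂ 0) :
    ∀ s ∈ Set.Icc (0 : ℝ) 1, ∀ s' ∈ Set.Icc (0 : ℝ) 1, ∀ g : G,
      |Real.log ((fun s : ℝ => if s ≤ 1 / 2 then w₁ (2 * s) else w₂ (2 * s - 1)) s g) -
          Real.log ((fun s : ℝ => if s ≤ 1 / 2 then w₁ (2 * s) else w₂ (2 * s - 1)) s' g)| ≤
        2 * (|Λ₁| + |Λ₂|) * |s - s'| := by
  intro s hs s' hs' g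
  rcases le_total s s' with hle | hle
  · rw [abs_of_nonpos (sub_nonpos.mpr hle), neg_sub]
    exact concatPath_log_lipschitz_of_le hL₁ hL₂ hjoin hle hs hs' g
  · rw [abs_of_nonneg (sub_nonneg.mpr hle), abs_sub_comm]
    exact concatPath_log_lipschitz_of_le hL₁ hL₂ hjoin hle hs' hs g

/-- **Reduction of the crux `AnalyticDetour` to its open core.**  The anchored-detour statement
(`stub_anchoredDetour` of the skeleton, verbatim: off a locally finite `E`, from anchors
arbitrarily deep in strong coupling every Wilson point `β > 0`, `β ∉ E` is reached by an admissible
weight path with Gateaux-analytic torus pressure) IMPLIES the route decl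
`Summit.QuantumFields.YangMills.Theses.GronwallGap.AnalyticDetour`: `β₁` from the window theorem
`stub_strongCouplingWindow`, `E` and an anchor `βa ∈ (0, β₁)` from the hypothesis (`b := β₁`);
for `β ∉ E`, `βs ∈ (0, β₁)` concatenate the window path `βs ⇝ βa` with the detour `βa ⇝ β`.
CONDITIONAL on its hypothesis (open mathematics); closes nothing by itself. -/
theorem stub_reductionToAnchoredDetour :
    (∀ (G : Type) [Group G] [TopologicalSpace G] [IsTopologicalGroup G] [CompactSpace G], Literature.MathematicalPhysics.QuantumFieldTheory.IsCompactSimpleLieGroup G → letI : MeasurableSpace G := borel G; haveI : BorelSpace G := ⟨rfl⟩; let Pseq : (G → ℝ) → ℕ → ℝ := fun v L => (((L + 1 : ℕ) : ℝ) ^ 4)⁻¹ * Real.log (((MeasureTheory.Measure.pi fun _ : Literature.MathematicalPhysics.QuantumFieldTheory.Edge 4 (L + 1) => Literature.MathematicalPhysics.QuantumFieldTheory.haarProbability G).withDensity (fun U : Literature.MathematicalPhysics.QuantumFieldTheory.GaugeConfig 4 (L + 1) G => ENNReal.ofReal (Literature.MathematicalPhysics.QuantumLattice.groupHeatKernelWeight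 (fun _ : ℝ => v) 0 U))) Set.univ).toReal; let AnP : (G → ℝ) → Prop := fun v => ∀ φ : G → ℝ, Continuous φ → (∀ g h : G, φ (h * g * h⁻¹) = φ g) → ∃ p : ℝ → ℝ, (∀ t : ℝ, Filter.Tendsto (fun L : ℕ => Pseq (fun g => v g * Real.exp (t * φ g)) L) Filter.atTop (nhds (p t))) ∧ AnalyticAt ℝ p 0; let Adm : (ℝ → G → ℝ) → Prop := fun w => (∀ s ∈ Set.Icc (0 : ℝ) 1, Continuous (w s) ∧ (∀ g : G, 0 < w s g) ∧ (∀ g h : G, w s (h * g * h⁻¹) = w s g) ∧ (∀ g : G, w s g⁻¹ = w s g) ∧ (∀ (n : ℕ) (x : Fin n → G) (c : Fin n → ℂ), 0 ≤ (∑ i, ∑ j, (starRingEnd ℂ) (c i) * c j * ((w s ((x i)⁻¹ * x j) : ℝ) : ℂ)).re)) ∧ ∃ Λ : ℝ, ∀ s ∈ Set.Icc (0 : ℝ) 1, ∀ s' ∈ Set.Icc (0 : ℝ) 1, ∀ g : G, |Real.log (w s g) - Real.log (w s' g)| ≤ Λ * |s - s'|; ∀ r : Literature.MathematicalPhysics.QuantumFieldTheory.LatticeRep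 G, ∃ E : Set ℝ, (∀ b : ℝ, (E ∩ Set.Icc 0 b).Finite) ∧ ∀ b : ℝ, 0 < b → ∃ βa ∈ Set.Ioo (0 : ℝ) b, ∀ β : ℝ, 0 < β → β ∉ E → ∃ w : ℝ → G → ℝ, Adm w ∧ (∀ s ∈ Set.Icc (0 : ℝ) 1, AnP (w s)) ∧ w 0 = (fun g => Real.exp (βa * (r.ρ g).trace.re)) ∧ w 1 = (fun g => Real.exp (β * (r.ρ g).trace.re))) → Summit.QuantumFields.YangMills.Theses.GronwallGap.AnalyticDetour := by
  intro h2 G i1 i2 i3 i4 hG Pseq AnP Adm r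
  obtain ⟨β₁, hβ₁, hwin⟩ := stub_strongCouplingWindow G hG r
  obtain ⟨E, hE, hanch⟩ := h2 G hG r
  obtain ⟨βa, hβa, hdet⟩ := hanch β₁ hβ₁
  refine ⟨E, hE, β₁, hβ₁, fun β hβ hβE βs hβs => ?_⟩
  obtain ⟨w₁, hAdm₁, hAn₁, hw₁0, hw₁1⟩ := hwin βs hβs βa hβa
  obtain ⟨w₂, hAdm₂, hAn₂, hw₂0, hw₂1⟩ := hdet β hβ hβE
  have hjoin : w₁ 1 = w₂ 0 := hw₁1.trans hw₂0.symm
  obtain ⟨Λ₁, hL₁⟩ := hAdm₁.2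
  obtain ⟨Λ₂, hL₂⟩ := hAdm₂.2
  refine ⟨fun s => if s ≤ 1 / 2 then w₁ (2 * s) else w₂ (2 * s - 1), ?_,
    concatPath_forall AnP hAn₁ hAn₂, ?_, ?_⟩
  · exact And.intro
      (concatPath_forall (fun v : G → ℝ => Continuous v ∧ (∀ g : G, 0 < v g) ∧
          (∀ g h : G, v (h * g * h⁻¹) = v g) ∧ (∀ g : G, v g⁻¹ = v g) ∧
          (∀ (n : ℕ) (x : Fin n → G) (c : Fin n → ℂ),
            0 ≤ (∑ i, ∑ j, (starRingEnd ℂ) (c i) * c j * ((v ((x i)⁻¹ * x j) : ℝ) : ℂ)).re))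
        hAdm₁.1 hAdm₂.1)
      ⟨2 * (|Λ₁| + |Λ₂|), concatPath_log_lipschitz hL₁ hL₂ hjoin⟩
  · have h0 : ((0 : ℝ) ≤ 1 / 2) := by norm_num
    simp only [if_pos h0, mul_zero]
    exact hw₁0
  · have h1 : ¬ ((1 : ℝ) ≤ 1 / 2) := by norm_num
    simp only [if_neg h1]
    norm_num
    exact hw₂1

end Summit.QuantumFields.YangMills.Theorems

end
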